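import Mathlib
import HarnessLib

/-!
# Route `KimAtThreeKolyvagin` (rung W2), crux `StubAtEmptyLevelThree` (item 19561): the ALGEBRA of
# Mazur–Rubin's "sufficiently liftable" stub theorem (Mem. AMS 799, Thm. 4.4.3, Case 1) — a liftable
# class of the right order lies in the stub

Cell `bsd-addord`, seat `bsd-addord-w2-c2` (gen 3; director-bsd 2026-08-26T11:01Z: W2 hand on item 19561
after the glues). TOOL FILE, pure finite-abelian-group algebra (no Galois cohomology, no elliptic curve):
theorems only, no definition, no named fact, no `sorry`; closes nothing; books nothing. HONEST FRAMING:
BSD is not proved by any of this; item 19561 (the STUB AT THE EMPTY LEVEL at general modulus `3^m`,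
Mazur–Rubin 2004 Thm. 4.4.1 / 4.3.4 transported to `p = 3`) stays OPEN; this file isolates the module
theory of ONE printed road to it, so that the Galois-cohomological inputs can be discharged separately in
cell n1011's currency (`GaloisImage.*`).

## The road (Mazur–Rubin, *Kolyvagin systems*, Thm. 4.4.3, p. 46–47, Case 1, read at the level `n = 1`)

Let `R = ℤ/p^m`, `T = E[p^m]`, and let `T̃ = E[p^{j+m}]` be a LIFT (`R̃ = ℤ/p^{j+m}`, `j ≥ m − 1` is MR's
"`k̃ ≥ 2k − 1`"). Write `M = H¹_{𝓕}(ℚ, T̃)` (propagated Selmer group of the lift), `φ = red_*` the map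
induced by the reduction `T̃ ↠ T` (multiplication by `p^j` on points), so that `ker φ = M[p^j]`
(MR Lemma 4.1.1 (i)). If the class `x = κ₁ ∈ H¹_𝓕(ℚ, T)` of a Kolyvagin system is LIFTABLE (`x ∈ φ(M)`)
and has order dividing `p^{m−n₀}` (for `R = ℤ/p^m` this is [S24] Thm. 4.4 (2): `ord(κ₁)·#H¹_{𝓕*} = p^m`,
`#H¹_{𝓕*} = p^{n₀}`), then `x ∈ p^{n₀}·φ(M) ⊆ p^{n₀} H¹_𝓕(ℚ, T)` — THE STUB — as soon as `φ(M)` is a free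
`ℤ/p^m`-module of rank one; and `φ(M) ≅ M/M[p^j]` is cyclic of order `p^m` as soon as the three counts
`#M[p^j] = p^{j+c}`, `#M[p^{j+m−1}] = p^{j+m−1+c}`, `#M = p^{j+m+c}` hold (MR Thm. 4.1.13 with
`χ(T) = 1`: `#H¹_𝓕(ℚ, E[p^i]) = p^i · #H¹_{𝓕*}` and the dual Selmer group SATURATES, `c = n₀`, once
`n₀ < m ≤ j + 1` — MR's "`λ(n, T̃*) = j ≤ k̃ − k`").

## What is here (all `p` prime, all groups additive commutative)

* `exists_eq_nsmul_of_mem_zmultiples` — in the cyclic group `ℤ·z` with `ord z = p^m`: an element killed by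
  `p^{m−n₀}` (`n₀ ≤ m`) is `p^{n₀}·e` for some `e ∈ ℤ·z`.
* `addOrderOf_map_eq_pow_of_ker` — for `φ : M →+ H` with `ker φ = M[p^j]`: an element `y` with
  `p^{j+m−1}·y ≠ 0`, `p^{j+m}·y = 0` maps to an element of order exactly `p^m`.
* `natCard_range_eq_of_ker` — `#φ(M) = p^m` from `#M = p^{j+m+c}` and `#M[p^j] = p^{j+c}`.
* `range_eq_zmultiples_of_counts` — `φ(M) = ℤ·φ(y)` is cyclic of order `p^m` (the three counts).
* `exists_mem_range_eq_nsmul_of_liftable` — THE PACKAGED STUB ALGEBRA: `x ∈ φ(M)`, `p^{m−n₀}·x = 0`,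
  the three counts ⟹ `∃ e ∈ φ(M), x = p^{n₀}·e`.
* `nsmul_eq_zero_of_addOrderOf_mul_eq` — [S24] Thm. 4.4 (2) clause 1 (`ord(x)·p^{n₀} = p^m`) ⟹ `n₀ ≤ m` and
  `p^{m−n₀}·x = 0`; `exists_stubShape_of_liftable` / `exists_stubShape_of_eq_zero` — the conclusion in the
  literal shape of item 19561 (`x = p^{n₀}·e + m'`, `e ∈ S ⊇ φ(M)`, `m' ∈ K`, here `m' = 0`) from clause 1
  (liftable case) / clause 2 (`x = 0`).

What is NOT here (the inputs a successor discharges in n1011's currency, see the seat's HANDOFF): the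
reduction map on `H¹` and its kernel (dévissage `0 → E[p^j] → E[p^{j+m}] → E[p^m] → 0`, `H⁰ = 0`);
liftability of the generator's bottom class (evaluation at a common core vertex is bijective at both
levels: [S24] Thm. 4.4 (1) + `TorsionLevel.injective_eval_kolyvaginSystems_allDepths`); the three counts
(`DeepLedger.natCard_selmerGroup_propagated_eq` + saturation of the dual Selmer group, MR Lemma 4.1.1 (ii));
the order bound ([S24] Thm. 4.4 (2), `Sakamoto2024.kolyvaginSystems_idealOfBasis_eq_fittingIdeal_zmod_three_pow`).

References: B. Mazur, K. Rubin, *Kolyvagin systems*, Mem. AMS 168/799 (2004), Lemma 4.1.1, Thm. 4.1.13,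
Thm. 4.4.1, Thm. 4.4.3 (pp. 35–47; held text `HOME/lit/mazurrubin2004/txt-authors-pdf/p0041–p0053`)
[MazurRubin2004]; R. Sakamoto, JTNB 36 (2024) Thm. 4.4 [Sakamoto2024]; K. Rubin, PCMI 18 (2011) Thm. 2.8.4
[Rubin2011].
-/

-- the Theorems namespace of a single-conjunct summit repeats the summit name by design (D-0017)
set_option linter.dupNamespace false

namespace Summit.BirchSwinnertonDyer.BirchSwinnertonDyer.Theorems.KimAtThreeStubOfLiftable

variable {M H : Type*} [AddCommGroup M] [AddCommGroup H]

/-- **Divisibility inside a cyclic group from an order bound.** If `z` has additive order `p^m`, `x ∈ ℤ·z`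
and `p^{m−n₀}·x = 0` with `n₀ ≤ m`, then `x = p^{n₀}·e` for some `e ∈ ℤ·z` (write `x = a·z`; `p^m ∣ p^{m−n₀}a`
forces `p^{n₀} ∣ a`). The `R = ℤ/p^m` reading of "an element of `R` killed by `𝔪^{m−n₀}` lies in `𝔪^{n₀}`".
[cite: MazurRubin2004, Thm. 4.4.3 (proof, Case 1, p. 47)] -/
theorem exists_eq_nsmul_of_mem_zmultiples {p m n₀ : ℕ} (hp : p.Prime) {z x : H}
    (hz : addOrderOf z = p ^ m) (hx : x ∈ AddSubgroup.zmultiples z) (hn : n₀ ≤ m)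
    (hkill : p ^ (m - n₀) • x = 0) :
    ∃ e ∈ AddSubgroup.zmultiples z, x = p ^ n₀ • e := by
  obtain ⟨a, rfl⟩ := AddSubgroup.mem_zmultiples_iff.mp hx
  -- `p^m ∣ p^{m-n₀} * a`
  have hdvd : ((p : ℤ) ^ m) ∣ (p : ℤ) ^ (m - n₀) * a := by
    have h0 : ((p : ℤ) ^ (m - n₀) * a) • z = 0 := by
      rw [mul_zsmul, ← Int.natCast_pow, natCast_zsmul, hkill]
    have := (addOrderOf_dvd_iff_zsmul_eq_zero).mpr h0
    rw [hz] at this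
    exact_mod_cast this
  -- cancel `p^{m-n₀}`
  have hsplit : (p : ℤ) ^ m = (p : ℤ) ^ (m - n₀) * (p : ℤ) ^ n₀ := by
    rw [← pow_add, Nat.sub_add_cancel hn]
  rw [hsplit] at hdvd
  have hne : (p : ℤ) ^ (m - n₀) ≠ 0 := pow_ne_zero _ (by exact_mod_cast hp.ne_zero)
  obtain ⟨b, hb⟩ := (mul_dvd_mul_iff_left hne).mp hdvd
  refine ⟨b • z, (AddSubgroup.zmultiples z).zsmul_mem (AddSubgroup.mem_zmultiples z) b, ?_⟩
  rw [hb, mul_zsmul, ← Int.natCast_pow, natCast_zsmul]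

/-- **Order of the image of a deep class under a map whose kernel is the `p^j`-torsion.** If
`ker φ = M[p^j]` (as for the reduction `H¹(ℚ, E[p^{j+m}]) → H¹(ℚ, E[p^m])`, MR Lemma 4.1.1 (i)) and
`p^{j+m−1}·y ≠ 0`, `p^{j+m}·y = 0`, then `φ y` has order exactly `p^m`.
[cite: MazurRubin2004, Lemma 4.1.1 (i) (p. 35) and Thm. 4.4.3 (p. 47)] -/
theorem addOrderOf_map_eq_pow_of_ker {p : ℕ} [hp : Fact p.Prime] (φ : M →+ H) {j m : ℕ} (hm : 1 ≤ m)
    (hker : ∀ y : M, φ y = 0 ↔ p ^ j • y = 0) {y : M} (hy : p ^ (j + m - 1) • y ≠ 0)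
    (hy0 : p ^ (j + m) • y = 0) : addOrderOf (φ y) = p ^ m := by
  obtain ⟨m', rfl⟩ : ∃ m', m = m' + 1 := ⟨m - 1, (Nat.sub_add_cancel hm).symm⟩
  refine addOrderOf_eq_prime_pow (p := p) (n := m') ?_ ?_
  · intro h
    apply hy
    rw [← map_nsmul, hker, smul_smul, ← pow_add] at h
    have e : j + (m' + 1) - 1 = j + m' := by omega
    rwa [e]
  · rw [← map_nsmul, hker, smul_smul, ← pow_add]
    exact hy0

/-- **`#φ(M) = p^m`** from `#M = p^{j+m+c}` and `#ker φ = #M[p^j] = p^{j+c}` (first isomorphism theorem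
and Lagrange). [cite: MazurRubin2004, Thm. 4.1.13 (p. 38) and Thm. 4.4.3 (p. 47)] -/
theorem natCard_range_eq_of_ker [Finite M] {p : ℕ} (hp : p.Prime) (φ : M →+ H) {j m c : ℕ}
    (hker : ∀ y : M, φ y = 0 ↔ p ^ j • y = 0)
    (hcardM : Nat.card M = p ^ (j + m + c))
    (hcardj : Nat.card {y : M // p ^ j • y = 0} = p ^ (j + c)) :
    Nat.card φ.range = p ^ m := by
  classical
  have hkercard : Nat.card φ.ker = p ^ (j + c) := by
    rw [← hcardj]
    exact Nat.card_congr (Equiv.subtypeEquivRight fun y => by rw [AddMonoidHom.mem_ker, hker])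
  have h1 : Nat.card (M ⧸ φ.ker) = Nat.card φ.range :=
    Nat.card_congr (QuotientAddGroup.quotientKerEquivRange φ).toEquiv
  have h2 := φ.ker.card_eq_card_quotient_mul_card_addSubgroup
  rw [hcardM, h1, hkercard, show j + m + c = m + (j + c) by ring, pow_add] at h2
  have hpos : 0 < p ^ (j + c) := pow_pos hp.pos _
  exact (Nat.eq_of_mul_eq_mul_right hpos h2).symm

/-- **The image is cyclic of order `p^m`, generated by the image of any class of order `p^{j+m}`-ish**:
from the three counts `#M[p^j] = p^{j+c}`, `#M[p^{j+m−1}] = p^{j+m−1+c}`, `#M = p^{j+m+c}` (and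
`p^{j+m}·M = 0`) there is `y ∈ M` with `p^{j+m−1}·y ≠ 0`, and `φ(M) = ℤ·φ(y)` with `ord φ(y) = p^m`.
This is the freeness "the image of `H¹_{𝓕̃(n)}(ℚ, T̃)` in `H¹_{𝓕(n)}(ℚ, T)` is free of rank one" of MR's
Case 1. [cite: MazurRubin2004, Thm. 4.1.13 (p. 38) and Thm. 4.4.3 (Case 1, p. 47)] -/
theorem range_eq_zmultiples_of_counts [Finite M] {p : ℕ} [hp : Fact p.Prime] (φ : M →+ H) {j m c : ℕ}
    (hm : 1 ≤ m) (hker : ∀ y : M, φ y = 0 ↔ p ^ j • y = 0) (hM : ∀ y : M, p ^ (j + m) • y = 0)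
    (hcardM : Nat.card M = p ^ (j + m + c))
    (hcardj : Nat.card {y : M // p ^ j • y = 0} = p ^ (j + c))
    (hcardtop : Nat.card {y : M // p ^ (j + m - 1) • y = 0} = p ^ (j + m - 1 + c)) :
    ∃ y : M, addOrderOf (φ y) = p ^ m ∧ φ.range = AddSubgroup.zmultiples (φ y) := by
  classical
  -- a class not killed by `p^{j+m-1}`
  have hlt : Nat.card {y : M // p ^ (j + m - 1) • y = 0} < Nat.card M := by
    rw [hcardtop, hcardM]
    exact Nat.pow_lt_pow_right hp.out.one_lt (by omega)
  obtain ⟨y, hy⟩ : ∃ y : M, p ^ (j + m - 1) • y ≠ 0 := by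
    by_contra! h
    have : Nat.card {y : M // p ^ (j + m - 1) • y = 0} = Nat.card M :=
      Nat.card_congr (Equiv.subtypeUnivEquiv h)
    omega
  have hord : addOrderOf (φ y) = p ^ m := addOrderOf_map_eq_pow_of_ker φ hm hker hy (hM y)
  refine ⟨y, hord, ?_⟩
  -- `ℤ·φ(y) ≤ φ(M)`, same finite cardinality
  have hle : AddSubgroup.zmultiples (φ y) ≤ φ.range :=
    AddSubgroup.zmultiples_le.mpr ⟨y, rfl⟩
  have hcr : Nat.card φ.range = p ^ m := natCard_range_eq_of_ker hp.out φ hker hcardM hcardj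
  haveI : Finite φ.range := Nat.finite_of_card_ne_zero (by rw [hcr]; exact pow_ne_zero _ hp.out.ne_zero)
  symm
  refine AddSubgroup.eq_of_le_of_card_ge hle ?_
  rw [hcr, Nat.card_zmultiples, hord]

/-- **THE STUB ALGEBRA (Mazur–Rubin Thm. 4.4.3, Case 1, at one vertex).** Let `φ : M →+ H` have kernel
the `p^j`-torsion of the finite group `M`, `p^{j+m}·M = 0`, with the counts `#M[p^j] = p^{j+c}`,
`#M[p^{j+m−1}] = p^{j+m−1+c}`, `#M = p^{j+m+c}` (`1 ≤ m`). Then every LIFTABLE `x ∈ φ(M)` killed by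
`p^{m−n₀}` (`n₀ ≤ m`) is `p^{n₀}`-DIVISIBLE INSIDE `φ(M)`: `x = p^{n₀}·e`, `e ∈ φ(M)`. Reading: `M` = the
propagated Selmer group of the lift `E[p^{j+m}]`, `φ` = reduction to `E[p^m]`, `x = κ₁` the bottom class
of a liftable Kolyvagin system with `ord(κ₁) ∣ p^{m−n₀}` ([S24] Thm. 4.4 (2), `p^{n₀} = #H¹_{𝓕*}`) ⟹
`κ₁ ∈ p^{n₀} H¹_𝓕(ℚ, E[p^m])`, the stub `𝓗′(1) = 𝔪^{λ(1,T*)}𝓗(1)`.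
[cite: MazurRubin2004, Thm. 4.4.3 (pp. 46–47) and Thm. 4.4.1 (p. 45)] [cite: Sakamoto2024, Thm. 4.4 (2) (p. 926)] -/
theorem exists_mem_range_eq_nsmul_of_liftable [Finite M] {p : ℕ} [hp : Fact p.Prime] (φ : M →+ H)
    {j m c n₀ : ℕ} (hm : 1 ≤ m) (hn : n₀ ≤ m)
    (hker : ∀ y : M, φ y = 0 ↔ p ^ j • y = 0) (hM : ∀ y : M, p ^ (j + m) • y = 0)
    (hcardM : Nat.card M = p ^ (j + m + c))
    (hcardj : Nat.card {y : M // p ^ j • y = 0} = p ^ (j + c))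
    (hcardtop : Nat.card {y : M // p ^ (j + m - 1) • y = 0} = p ^ (j + m - 1 + c))
    {x : H} (hx : x ∈ φ.range) (hkill : p ^ (m - n₀) • x = 0) :
    ∃ e ∈ φ.range, x = p ^ n₀ • e := by
  obtain ⟨y, hord, hrange⟩ := range_eq_zmultiples_of_counts φ hm hker hM hcardM hcardj hcardtop
  rw [hrange] at hx ⊢
  exact exists_eq_nsmul_of_mem_zmultiples hp.out hord hx hn hkill

/-- **From [S24] Thm. 4.4 (2), clause 1, to the order bound used above**: if `ord(x) · p^{n₀} = p^m` then
`n₀ ≤ m` and `p^{m−n₀}·x = 0`. (`ord(κ₁)·#H¹_{𝓕*} = p^m` is the `R = ℤ/p^m` unfolding of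
`I_R(κ₁) = Fitt⁰(H¹_{𝓕*}{}^∨)` in `Sakamoto2024.kolyvaginSystems_idealOfBasis_eq_fittingIdeal_zmod_three_pow`.)
[cite: Sakamoto2024, Thm. 4.4 (2) with Rem. 4.3 (p. 926)] -/
theorem nsmul_eq_zero_of_addOrderOf_mul_eq {p m n₀ : ℕ} (hp : p.Prime) {x : H}
    (h : addOrderOf x * p ^ n₀ = p ^ m) : n₀ ≤ m ∧ p ^ (m - n₀) • x = 0 := by
  have hdvd : p ^ n₀ ∣ p ^ m := Dvd.intro_left _ h
  have hn : n₀ ≤ m := (Nat.pow_dvd_pow_iff_le_right hp.one_lt).mp hdvd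
  refine ⟨hn, ?_⟩
  have hord : addOrderOf x = p ^ (m - n₀) := by
    have hsplit : p ^ m = p ^ (m - n₀) * p ^ n₀ := by rw [← pow_add, Nat.sub_add_cancel hn]
    rw [hsplit] at h
    exact Nat.eq_of_mul_eq_mul_right (pow_pos hp.pos _) h
  rw [← hord]
  exact addOrderOf_nsmul_eq_zero x

/-- **THE STUB IN THE SHAPE OF ITEM 19561's CONCLUSION** (`g ∅ = 3^{n₀} • e + m`, `e` in the Selmer group,
`m` in the Kummer Selmer group — here with `m = 0`): for any subgroups `S ⊇ φ(M)` (the propagated Selmer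
group of `E[p^m]`, which contains the reductions of the lift's Selmer classes) and `K` (the Kummer Selmer
group), a liftable `x` with `ord(x)·p^{n₀} = p^m` ([S24] Thm. 4.4 (2), clause 1) satisfies
`x = p^{n₀}·e + m` with `e ∈ S`, `m ∈ K`. Clause 2 of [S24] Thm. 4.4 (2) (`p^m ∣ #H¹_{𝓕*} ⟹ x = 0`) gives the
same shape with `e = m = 0`. The Galois-side inputs (kernel of the reduction, liftability, the three
counts) stay DISPLAYED. [cite: MazurRubin2004, Thm. 4.4.3 (pp. 46–47) and Thm. 4.4.1 (p. 45)]
[cite: Sakamoto2024, Thm. 4.4 (2) (p. 926)] -/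
theorem exists_stubShape_of_liftable [Finite M] {p : ℕ} [hp : Fact p.Prime] (φ : M →+ H)
    {j m c n₀ : ℕ} (hm : 1 ≤ m)
    (hker : ∀ y : M, φ y = 0 ↔ p ^ j • y = 0) (hM : ∀ y : M, p ^ (j + m) • y = 0)
    (hcardM : Nat.card M = p ^ (j + m + c))
    (hcardj : Nat.card {y : M // p ^ j • y = 0} = p ^ (j + c))
    (hcardtop : Nat.card {y : M // p ^ (j + m - 1) • y = 0} = p ^ (j + m - 1 + c))
    (S K : AddSubgroup H) (hS : φ.range ≤ S)
    {x : H} (hx : x ∈ φ.range) (hordx : addOrderOf x * p ^ n₀ = p ^ m) :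
    ∃ e ∈ S, ∃ m' ∈ K, x = p ^ n₀ • e + m' := by
  obtain ⟨hn, hkill⟩ := nsmul_eq_zero_of_addOrderOf_mul_eq hp.out hordx
  obtain ⟨e, he, rfl⟩ :=
    exists_mem_range_eq_nsmul_of_liftable φ hm hn hker hM hcardM hcardj hcardtop hx hkill
  exact ⟨e, hS he, 0, K.zero_mem, (add_zero _).symm⟩

/-- **Clause 2 of [S24] Thm. 4.4 (2) in the same shape**: if the bottom class vanishes (`p^m ∣ #H¹_{𝓕*}`,
i.e. `n₀ ≥ m`), the stub decomposition holds with `e = m = 0`. [cite: Sakamoto2024, Thm. 4.4 (2) (p. 926)] -/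
theorem exists_stubShape_of_eq_zero {p n₀ : ℕ} (S K : AddSubgroup H) {x : H} (hx : x = 0) :
    ∃ e ∈ S, ∃ m' ∈ K, x = p ^ n₀ • e + m' :=
  ⟨0, S.zero_mem, 0, K.zero_mem, by rw [hx, smul_zero, add_zero]⟩

end Summit.BirchSwinnertonDyer.BirchSwinnertonDyer.Theorems.KimAtThreeStubOfLiftable
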